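import Summits.RiemannHypothesis.RiemannHypothesis.Theorems.UniversalFactorLaplaceLoophole
import Summits.RiemannHypothesis.RiemannHypothesis.Theorems.UniversalFactorH0DecayStandalone
import Literature.NumberTheory.LFunctions.XiIntegralLimitProofs
import Literature.NumberTheory.LFunctions.DeBruijnNewmanConstProofs

/-!
# RiemannHypothesis / UniversalFactor — negative lemmas on the crux `LaplaceLoophole` (item stmt-RiemannHypothesis-2575)

Refuter (cdisprove) file, `--supports stmt-RiemannHypothesis-2575`. With
`F_a(z) = ∫₀^∞ Φ(u)(1 + u²/a²)⁻¹ cos(zu) du = deBruijnHDiv (fun u ↦ 1 + u²/a²) z` and the crux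
X = `LaplaceLoophole` = `∃ a > 0, HasOnlyRealZeros F_a`:

* **Load-bearing side condition `0 < a`.** In Lean `u²/0² = 0`, so `F_0 = H_0` verbatim
  (`deBruijnHDiv_laplace_zero`), and `F_{-a} = F_a`. Hence the crux WITHOUT `0 < a` is exactly the
  Riemann hypothesis (`exists_hasOnlyRealZeros_laplace_iff_riemannHypothesis`): any refutation of X must
  use `0 < a`, and X itself sits between RH (a := 0 admitted) and nothing weaker.
* **The `∀`-strengthening of X is false, and the loophole set is bounded away from `0`.** The residue
  `C(a) = ∫₀^∞ H_0(x) cosh(ax) dx` is continuous at `a = 0` (dominated convergence from the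
  Lagarias–Montague decay `e^{b|x|}|H_0(x)| ≤ C`, `b < π/8`) with
  `C(0) = ∫₀^∞ H_0 = (π/2)Φ(0) > 0` (Fourier inversion, `integral_riemannXi_criticalLine_Ioi`), so
  `C(a) ≠ 0` for all small `a > 0`, and the tree's `wideKernelNoGo` gives
  `∀ᶠ a in 𝓝[>] 0, ¬ HasOnlyRealZeros F_a` (`eventually_nhdsGT_not_hasOnlyRealZeros_laplace`), in
  particular `¬ ∀ a > 0, HasOnlyRealZeros F_a` (`not_forall_pos_hasOnlyRealZeros_laplace`).

Nothing here decides X.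
-/

noncomputable section

namespace Summit.RiemannHypothesis.RiemannHypothesis.Theorems

open MeasureTheory Set Filter Complex
open scoped Topology
open Literature.NumberTheory.LFunctions
open Summit.RiemannHypothesis.RiemannHypothesis.Theses

/-! ## The side condition `0 < a` is load-bearing: `a = 0` is RH -/

/-- In Lean `u ^ 2 / 0 ^ 2 = 0`, so the Laplace multiplier at `a = 0` is the constant `1` and
`F_0 = H_0`. [folklore] -/
theorem UniversalFactor.deBruijnHDiv_laplace_zero :
    deBruijnHDiv (fun u : ℝ => 1 + u ^ 2 / (0:ℝ) ^ 2) = deBruijnH 0 := by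
  have h : (fun u : ℝ => 1 + u ^ 2 / (0:ℝ) ^ 2) = fun _ : ℝ => (1:ℝ) := by
    funext u; simp
  rw [h]
  exact deBruijnHDiv_one'

/-- `F_{-a} = F_a`: the Laplace family only depends on `a²`. [folklore] -/
theorem UniversalFactor.deBruijnHDiv_laplace_neg (a : ℝ) :
    deBruijnHDiv (fun u : ℝ => 1 + u ^ 2 / (-a) ^ 2) = deBruijnHDiv (fun u : ℝ => 1 + u ^ 2 / a ^ 2) := by
  simp_rw [neg_sq]

/-- `F_{|a|} = F_a`. [folklore] -/
theorem UniversalFactor.deBruijnHDiv_laplace_abs (a : ℝ) :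
    deBruijnHDiv (fun u : ℝ => 1 + u ^ 2 / |a| ^ 2) = deBruijnHDiv (fun u : ℝ => 1 + u ^ 2 / a ^ 2) := by
  simp_rw [sq_abs]

/-- **`0 < a` is load-bearing**: at the junk value `a = 0` the crux's predicate is RH itself
(`F_0 = H_0` and `RH ↔ H_0` has only real zeros, `riemannHypothesis_iff_hasOnlyRealZeros_deBruijnH_zero_holds`).
[folklore] -/
theorem UniversalFactor.hasOnlyRealZeros_laplace_zero_iff_riemannHypothesis :
    HasOnlyRealZeros (fun z : ℂ => ∫ u in Set.Ioi (0:ℝ),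
        ((deBruijnPhi u / (1 + u ^ 2 / (0:ℝ) ^ 2) : ℝ) : ℂ) * Complex.cos (z * u)) ↔
      _root_.RiemannHypothesis := by
  change HasOnlyRealZeros (deBruijnHDiv fun u : ℝ => 1 + u ^ 2 / (0:ℝ) ^ 2) ↔ _
  rw [UniversalFactor.deBruijnHDiv_laplace_zero]
  exact riemannHypothesis_iff_hasOnlyRealZeros_deBruijnH_zero_holds.symm

/-- **The crux without its side condition `0 < a` is exactly RH.** Dropping `0 < a` from
`LaplaceLoophole` admits the junk witness `a = 0` (`F_0 = H_0`, RH) while every `a ≠ 0` gives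
`LaplaceLoophole` for `|a| > 0` and hence RH (`UniversalFactor.riemannHypothesis_of_laplaceLoophole`,
the Laguerre lift). So no refutation of the crux can avoid using `0 < a`. [folklore] -/
theorem UniversalFactor.exists_hasOnlyRealZeros_laplace_iff_riemannHypothesis :
    (∃ a : ℝ, HasOnlyRealZeros (fun z : ℂ => ∫ u in Set.Ioi (0:ℝ),
        ((deBruijnPhi u / (1 + u ^ 2 / a ^ 2) : ℝ) : ℂ) * Complex.cos (z * u))) ↔
      _root_.RiemannHypothesis := by
  constructor
  · rintro ⟨a, ha⟩
    rcases eq_or_ne a 0 with rfl | hne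
    · exact UniversalFactor.hasOnlyRealZeros_laplace_zero_iff_riemannHypothesis.1 ha
    · refine UniversalFactor.riemannHypothesis_of_laplaceLoophole ⟨|a|, abs_pos.2 hne, ?_⟩
      change HasOnlyRealZeros (deBruijnHDiv fun u : ℝ => 1 + u ^ 2 / |a| ^ 2)
      rw [UniversalFactor.deBruijnHDiv_laplace_abs]
      exact ha
  · intro h
    exact ⟨0, UniversalFactor.hasOnlyRealZeros_laplace_zero_iff_riemannHypothesis.2 h⟩

/-- The same dichotomy by name: `(∃ a, HasOnlyRealZeros F_a) ↔ (RH ∨ LaplaceLoophole)`, and the right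
disjunct implies the left one. [folklore] -/
theorem UniversalFactor.exists_hasOnlyRealZeros_laplace_iff_or :
    (∃ a : ℝ, HasOnlyRealZeros (fun z : ℂ => ∫ u in Set.Ioi (0:ℝ),
        ((deBruijnPhi u / (1 + u ^ 2 / a ^ 2) : ℝ) : ℂ) * Complex.cos (z * u))) ↔
      (_root_.RiemannHypothesis ∨ UniversalFactor.LaplaceLoophole) := by
  rw [UniversalFactor.exists_hasOnlyRealZeros_laplace_iff_riemannHypothesis]
  constructor
  · exact Or.inl
  · rintro (h | h)
    · exact h
    · exact UniversalFactor.riemannHypothesis_of_laplaceLoophole h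

/-! ## The residue `C(a) = ∫₀^∞ H_0(x) cosh(ax) dx`: continuity at `0` and `C(0) = (π/2)Φ(0) > 0` -/

/-- `∫₀^∞ H_0(x) dx = (π/2) Φ(0)`: substitute `x = 2t` in `H_0(x) = ξ(½ + ix/2)/8` and use
`∫₀^∞ ξ(½ + it) dt = 2πΦ(0)` (Fourier inversion; Lagarias–Montague Thm. 2.1 (1),
`integral_riemannXi_criticalLine_Ioi`). [cite: LagariasMontague2011, Thm. 2.1 (1)] -/
theorem UniversalFactor.integral_Ioi_deBruijnH_zero :
    ∫ x in Ioi (0:ℝ), deBruijnH 0 (x : ℂ) = ((Real.pi / 2 * deBruijnPhi 0 : ℝ) : ℂ) := by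
  set g : ℝ → ℂ := fun t ↦ riemannXi (1 / 2 + (t : ℂ) * I) / 8 with hg
  have h1 : ∀ x : ℝ, deBruijnH 0 (x : ℂ) = g (2⁻¹ * x) := by
    intro x
    rw [deBruijnH_zero_eq_holds, hg]
    congr 2
    push_cast
    ring
  simp_rw [h1]
  rw [integral_comp_mul_left_Ioi g 0 (by norm_num : (0:ℝ) < 2⁻¹), mul_zero, inv_inv]
  have h2 : ∫ t in Ioi (0:ℝ), g t = (xiIntegralLimit : ℂ) / 8 := by
    simp only [hg]
    rw [integral_div, integral_riemannXi_criticalLine_Ioi]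
  rw [h2, xiIntegralLimit]
  simp only [Complex.real_smul]
  push_cast
  ring

/-- `∫₀^∞ H_0(x) dx ≠ 0` (it equals `(π/2)Φ(0)` and `Φ(0) > 0`). [folklore] -/
theorem UniversalFactor.integral_Ioi_deBruijnH_zero_ne_zero :
    (∫ x in Ioi (0:ℝ), deBruijnH 0 (x : ℂ)) ≠ 0 := by
  rw [UniversalFactor.integral_Ioi_deBruijnH_zero, Complex.ofReal_ne_zero]
  have hΦ : 0 < deBruijnPhi 0 := deBruijnPhi_pos_holds 0
  positivity

/-- **Continuity of the residue at `a = 0`**: `a ↦ ∫₀^∞ H_0(x) cosh(ax) dx` is continuous at `0`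
(dominated convergence: for `|a| ≤ π/32`, `|H_0(x) cosh(ax)| ≤ C e^{−(π/32) x}` by the decay
`e^{(π/16)|x|}|H_0(x)| ≤ C`, `UniversalFactorStandalone.exists_exp_mul_norm_deBruijnH_zero_le`). [folklore] -/
theorem UniversalFactor.continuousAt_coshIntegral_zero :
    ContinuousAt (fun a : ℝ => ∫ x in Ioi (0:ℝ), deBruijnH 0 (x : ℂ) * (Real.cosh (a * x) : ℂ)) 0 := by
  have hb : Real.pi / 16 < Real.pi / 8 := by linarith [Real.pi_pos]
  obtain ⟨C, hC⟩ := UniversalFactorStandalone.exists_exp_mul_norm_deBruijnH_zero_le hb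
  have hHc : Continuous fun x : ℝ ↦ deBruijnH 0 (x : ℂ) :=
    (differentiable_deBruijnH_holds 0).continuous.comp Complex.continuous_ofReal
  have hmeas : ∀ a : ℝ, AEStronglyMeasurable
      (fun x : ℝ ↦ deBruijnH 0 (x : ℂ) * (Real.cosh (a * x) : ℂ)) (volume.restrict (Ioi (0:ℝ))) := by
    intro a
    exact (hHc.mul (Complex.continuous_ofReal.comp (Real.continuous_cosh.comp
      (continuous_const.mul continuous_id)))).aestronglyMeasurable
  have hsmall : ∀ᶠ a in 𝓝 (0:ℝ), |a| < Real.pi / 32 := by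
    have : Iio (Real.pi / 32) ∈ 𝓝 (|(0:ℝ)|) := by
      rw [abs_zero]; exact Iio_mem_nhds (by positivity)
    exact continuous_abs.continuousAt.preimage_mem_nhds this
  refine MeasureTheory.continuousAt_of_dominated (bound := fun x : ℝ ↦ C * Real.exp (-(Real.pi / 32) * x))
    (Eventually.of_forall hmeas) ?_ ?_ ?_
  · filter_upwards [hsmall] with a ha
    refine ae_restrict_of_forall_mem measurableSet_Ioi fun x (hx : 0 < x) ↦ ?_
    rw [norm_mul, Complex.norm_real, Real.norm_eq_abs, abs_of_pos (Real.cosh_pos _)]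
    have hcosh : Real.cosh (a * x) ≤ Real.exp (Real.pi / 32 * x) := by
      rw [Real.cosh_eq]
      have h1 : Real.exp (a * x) ≤ Real.exp (Real.pi / 32 * x) :=
        Real.exp_le_exp.2 (by nlinarith [le_abs_self a])
      have h2 : Real.exp (-(a * x)) ≤ Real.exp (Real.pi / 32 * x) :=
        Real.exp_le_exp.2 (by nlinarith [neg_abs_le a])
      linarith
    have hHx : ‖deBruijnH 0 (x : ℂ)‖ ≤ C * Real.exp (-(Real.pi / 16) * x) := by
      have h := hC x
      rw [abs_of_pos hx] at h
      have he : Real.exp (Real.pi / 16 * x) * Real.exp (-(Real.pi / 16) * x) = 1 := by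
        rw [← Real.exp_add]; simp
      calc ‖deBruijnH 0 (x : ℂ)‖
          = Real.exp (Real.pi / 16 * x) * ‖deBruijnH 0 (x : ℂ)‖ * Real.exp (-(Real.pi / 16) * x) := by
            rw [mul_comm (Real.exp _), mul_assoc, he, mul_one]
        _ ≤ C * Real.exp (-(Real.pi / 16) * x) :=
            mul_le_mul_of_nonneg_right h (Real.exp_pos _).le
    have hC0 : 0 ≤ C := le_trans (by positivity) (hC 0)
    calc ‖deBruijnH 0 (x : ℂ)‖ * Real.cosh (a * x)
        ≤ C * Real.exp (-(Real.pi / 16) * x) * Real.exp (Real.pi / 32 * x) :=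
          mul_le_mul hHx hcosh (Real.cosh_pos _).le (by positivity)
      _ = C * Real.exp (-(Real.pi / 32) * x) := by
          rw [mul_assoc, ← Real.exp_add]; ring_nf
  · exact ((exp_neg_integrableOn_Ioi 0 (by positivity : (0:ℝ) < Real.pi / 32)).const_mul C).congr
      (ae_of_all _ fun x ↦ by ring_nf)
  · refine ae_of_all _ fun x ↦ ?_
    exact (continuous_const.mul (Complex.continuous_ofReal.comp (Real.continuous_cosh.comp
      (continuous_id.mul continuous_const)))).continuousAt

/-- The residue is non-zero for every real `a` near `0`: `C(0) = ∫₀^∞ H_0 = (π/2)Φ(0) ≠ 0` and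
continuity. [folklore] -/
theorem UniversalFactor.eventually_coshIntegral_ne_zero :
    ∀ᶠ a in 𝓝 (0:ℝ), (∫ x in Ioi (0:ℝ), deBruijnH 0 (x : ℂ) * (Real.cosh (a * x) : ℂ)) ≠ 0 := by
  have h0 : (∫ x in Ioi (0:ℝ), deBruijnH 0 (x : ℂ) * (Real.cosh ((0:ℝ) * x) : ℂ)) ≠ 0 := by
    simp only [zero_mul, Real.cosh_zero, Complex.ofReal_one, mul_one]
    exact UniversalFactor.integral_Ioi_deBruijnH_zero_ne_zero
  exact UniversalFactor.continuousAt_coshIntegral_zero.eventually_ne h0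

/-! ## Consequences for the crux: all sufficiently wide smoothings fail -/

/-- **Generalised Newman holds for all sufficiently wide Laplace kernels**: for every `a > 0` small
enough, `F_a` has a non-real zero. (`wideKernelNoGo` of the tree needs the residue
`∫₀^∞ H_0 cosh(a·) ≠ 0`, which holds near `a = 0⁺` by `eventually_coshIntegral_ne_zero`.) In
particular the set of `a > 0` realising the loophole is bounded away from `0`. [folklore] -/
theorem UniversalFactor.eventually_nhdsGT_not_hasOnlyRealZeros_laplace :
    ∀ᶠ a in 𝓝[>] (0:ℝ), ¬ HasOnlyRealZeros (fun z : ℂ => ∫ u in Set.Ioi (0:ℝ),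
      ((deBruijnPhi u / (1 + u ^ 2 / a ^ 2) : ℝ) : ℂ) * Complex.cos (z * u)) := by
  have h1 : ∀ᶠ a in 𝓝[>] (0:ℝ), (∫ x in Ioi (0:ℝ), deBruijnH 0 (x : ℂ) * (Real.cosh (a * x) : ℂ)) ≠ 0 :=
    eventually_nhdsWithin_of_eventually_nhds UniversalFactor.eventually_coshIntegral_ne_zero
  have h2 : ∀ᶠ a in 𝓝[>] (0:ℝ), 0 < a := eventually_mem_nhdsWithin
  have h3 : ∀ᶠ a in 𝓝[>] (0:ℝ), a < Real.pi / 8 :=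
    eventually_nhdsWithin_of_eventually_nhds (Iio_mem_nhds (by positivity))
  filter_upwards [h1, h2, h3] with a ha1 ha2 ha3
  exact UniversalFactorStandalone.wideKernelNoGo a ha2 ha3 ha1

/-- There is a wide kernel `0 < a < π/8` whose smoothing `F_a` has a non-real zero. [folklore] -/
theorem UniversalFactor.exists_wide_not_hasOnlyRealZeros_laplace :
    ∃ a : ℝ, 0 < a ∧ a < Real.pi / 8 ∧ ¬ HasOnlyRealZeros (fun z : ℂ => ∫ u in Set.Ioi (0:ℝ),
      ((deBruijnPhi u / (1 + u ^ 2 / a ^ 2) : ℝ) : ℂ) * Complex.cos (z * u)) := by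
  have h2 : ∀ᶠ a in 𝓝[>] (0:ℝ), 0 < a := eventually_mem_nhdsWithin
  have h3 : ∀ᶠ a in 𝓝[>] (0:ℝ), a < Real.pi / 8 :=
    eventually_nhdsWithin_of_eventually_nhds (Iio_mem_nhds (by positivity))
  obtain ⟨a, ha, hb, hc⟩ :=
    (h2.and (h3.and UniversalFactor.eventually_nhdsGT_not_hasOnlyRealZeros_laplace)).exists
  exact ⟨a, ha, hb, hc⟩

/-- **The `∀`-strengthening of the crux is false**: not every Laplace smoothing `F_a`, `a > 0`, is
in the Laguerre–Pólya class. (Refuted natural strengthening `∃ ↦ ∀` of `LaplaceLoophole`.) [folklore] -/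
theorem UniversalFactor.not_forall_pos_hasOnlyRealZeros_laplace :
    ¬ ∀ a : ℝ, 0 < a → HasOnlyRealZeros (fun z : ℂ => ∫ u in Set.Ioi (0:ℝ),
      ((deBruijnPhi u / (1 + u ^ 2 / a ^ 2) : ℝ) : ℂ) * Complex.cos (z * u)) := by
  intro h
  obtain ⟨a, ha, -, hna⟩ := UniversalFactor.exists_wide_not_hasOnlyRealZeros_laplace
  exact hna (h a ha)

end Summit.RiemannHypothesis.RiemannHypothesis.Theorems
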